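import Summits.HodgeConjecture.HodgeConjecture.Theses.PeriodDeficiency
import Summits.HodgeConjecture.HodgeConjecture.Theses.MotivatedLefschetzSplit
import Summits.HodgeConjecture.HodgeConjecture.Theorems.PeriodDeficiencyHodgeConjectureQbarStubLefschetzRange
import Summits.HodgeConjecture.HodgeConjecture.Theorems.PeriodDeficiencyHodgeConjectureQbarStubLefschetzTransfer
import Literature.AlgebraicGeometry.HodgeTheory.MotivatedClassesProofs
import HarnessLib

/-!
# Route PeriodDeficiency — crux `HodgeConjectureQbar` (stmt-HodgeConjecture-11596) from the items of route `MotivatedLefschetzSplit`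

A CONDITIONAL result (cross-route bridge), recorded so that the ledger carries the dependency that
the lead of line `registered` of the crux `HodgeConjectureQbar` (the Hodge conjecture, on the real
carriers, for smooth projective complex varieties with a `ℚ̄`-model) established in its reshaped
skeleton (`Cruxes/HodgeConjectureQbar/Lines/birth.lean`): once the Lefschetz range (stub A,
`stub_hodgeClassesAlgebraicQbar_lefschetzRange`, landed) and the hard-Lefschetz transfer of
motivated-ness above the middle degree (stub D, `stub_lefschetzTransferMotivatedQbar`, landed) are
proved, the crux follows from three items of route `MotivatedLefschetzSplit`:

* `HodgeClassesMotivated` (stmt-HodgeConjecture-17488, crux, OPEN): on every smooth projective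
  complex `X`, rational `(p,p)`-classes with `2 ≤ p`, `2p ≤ dim X` are motivated (André 1996 §0.4);
* `LefschetzStandardB` (stmt-HodgeConjecture-17489, crux, OPEN): Grothendieck's standard conjecture
  of Lefschetz type, André's `*_L`-form, for every smooth projective complex `Z`;
* `DiagonalPullbackAlgebraic` (stmt-HodgeConjecture-17490, support, known — Voisin II Prop. 9.21 (i)):
  diagonal pull-back preserves the coniveau.

Proof: for `X = X₀ ×_{ℚ̄,σ} ℂ` smooth projective of dimension `n` and a rational `(p,p)`-class `c`:
`p ≤ 1 ∨ n ≤ p + 1` — stub A (Lefschetz `(1,1)` + hard Lefschetz, unconditional); `2 ≤ p`, `2p ≤ n`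
— `c` is motivated by `HodgeClassesMotivated`; `n < 2p ≤ 2n − 4` — motivated by stub D from the
deep half; and motivated classes are algebraic by `LefschetzStandardB` + `DiagonalPullbackAlgebraic`
through the tree's PROVED reduction
`motivatedClasses_le_algebraicClasses_of_standardConjectureB_of_map_diagonal` (André 1996 §2.1
remark made explicit, `HodgeTheory/MotivatedClassesProofs`). The anti-vacuity conjunct
`Nonempty (HodgeModel n X)` of `HodgeConjectureFor` is the PROVED route item `HodgeModelsExist_holds`.

This is weaker than route `MotivatedLefschetzSplit`'s own assembly (`HM ∧ B ∧ Δ ∧ …` give the whole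
Hodge conjecture, of which the crux is the `ℚ̄`-specialisation); it is landed to pin, on the
ledger, where the two open stubs of this crux's only line sit in the hub.

## References

* [Andre1996Motifs] Y. André, Pour une théorie inconditionnelle des motifs, Publ. Math. IHÉS 83
  (1996), §0.4, §2.1 (Déf. 1, remark, Prop. 2.1).
* [VoisinHodgeI2002] C. Voisin, Hodge Theory and Complex Algebraic Geometry I, Thm. 6.25, Thm. 11.30.
* [VoisinHodgeII2003] C. Voisin, Hodge Theory and Complex Algebraic Geometry II, Prop. 9.20–9.21.
-/

-- every declaration of this problem lives in `Summit.HodgeConjecture.HodgeConjecture.…` (summit = sub-problem)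
set_option linter.dupNamespace false

namespace Summit.HodgeConjecture.HodgeConjecture.Theorems

open Literature.AlgebraicGeometry.Motives Literature.AlgebraicGeometry.HodgeTheory
open Summit.HodgeConjecture.HodgeConjecture.Theses

/-- **HC(ℚ̄) from `HM`, `B` and `Δ`** (conditional, cross-route bridge): the crux
`PeriodDeficiency.HodgeConjectureQbar` follows from the `MotivatedLefschetzSplit` items
`HodgeClassesMotivated` (stmt-HodgeConjecture-17488), `LefschetzStandardB` (stmt-HodgeConjecture-17489)
and `DiagonalPullbackAlgebraic` (stmt-HodgeConjecture-17490), the Lefschetz range and the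
hard-Lefschetz transfer being the landed theorems `stub_hodgeClassesAlgebraicQbar_lefschetzRange`
and `stub_lefschetzTransferMotivatedQbar`, and "`B` + `Δ` ⇒ motivated ⊆ algebraic" the tree's
`motivatedClasses_le_algebraicClasses_of_standardConjectureB_of_map_diagonal`. -/
theorem periodDeficiency_hodgeConjectureQbar_of_motivatedLefschetzSplit
    (hHM : MotivatedLefschetzSplit.HodgeClassesMotivated)
    (hB : MotivatedLefschetzSplit.LefschetzStandardB)
    (hΔ : MotivatedLefschetzSplit.DiagonalPullbackAlgebraic) :
    PeriodDeficiency.HodgeConjectureQbar := by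
  unfold PeriodDeficiency.HodgeConjectureQbar
  intro σ n X₀ hX
  refine ⟨PeriodDeficiency.HodgeModelsExist_holds n _ hX, fun p c hc hpp ↦ ?_⟩
  by_cases hp : p ≤ 1 ∨ n ≤ p + 1
  · -- the Lefschetz range (stub A, landed)
    exact stub_hodgeClassesAlgebraicQbar_lefschetzRange σ hX p hp c hc hpp
  · -- the middle range `2 ≤ p ≤ n - 2`: motivated (HM below the middle, stub D above), then `B` + `Δ`
    refine motivatedClasses_le_algebraicClasses_of_standardConjectureB_of_map_diagonal hΔ hB hX p ?_
    by_cases h2 : 2 * p ≤ n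
    · exact hHM hX p (by omega) h2 c hc hpp
    · exact stub_lefschetzTransferMotivatedQbar σ hX
        (fun q hq2 hqn c' hc' hqq ↦ hHM hX q hq2 hqn c' hc' hqq) p (by omega) (by omega) c hc hpp

end Summit.HodgeConjecture.HodgeConjecture.Theorems
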